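import Summits.ResolutionOfSingularities.ResolutionOfSingularities.Theorems.PurelyInseparableDim4ResConeNear
import HarnessLib
import HarnessLib.Audit.Tags

/-!
# Purely inseparable four-folds — towards the TRANSPORT OF THE TAME CONE across a constant-`d` point step
# (idea-4 I-4-6 (VT)(ii)): kill-variable / shear calculus and the top monomial of `shear(x^r)` (FILE 3a,
# cell `res-dim4-pi`, K2(p) lane)

[OURS · counted 0 · cell `res-dim4-pi` · desk WORD #55 (a), crit-4 g2 V-A4-13 GO · seat res-dim4-p-12 g2.]
Nothing here proves K2(p), `NoIsolatedTrap p p` or resolution of singularities in dimension ≥ 4 /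
characteristic `p`.

After `…ResConeNear` (FILE 2b): at a constant-shade point step in the band the sheared residual cone
`shear j b g` is `x_j`-free.  This file prepares the identification of the `x_j`-FREE LAYER of the NEW
residual cone (`coeff_ν (resForm s′) = c · coeff_ν (shear j b g)`, `ν_j = 0`, FILE 3b) with:

* §1 calculus: `coeff_killVar`, `pderiv_killVar_of_ne`, **`polarMap_killVar`** (`w_j = 0`: polars commute
  with `x_j ↦ 0`); `pderiv_shear_of_ne` (chain rule); `coeff_chartTransform_chartExponent'` (no support
  hypothesis).
* §2 the monomials of `shear j b (x^r)`: they all lie above `x^{r_kept}` (`le_of_mem_support_shear_monomial`)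
  and have degree `|r|`, so the ONLY one with maximal `x_j`-exponent `A = r_j + Σ_{lost} r_i` is
  `topMonomial = x_j^A · x^{r_kept}` (`eq_topMonomial_of_apply_eq`, `degree_topMonomial`).
FILE 3b (`…ResConeLayer` / `…ResConeVertexDrop`): the `x_j`-free LAYER of the new residual cone
(`coeff_ν (resForm s′) = c · coeff_ν (shear j b g)` for `ν_j = 0`, (VT)(ii)), hence
`Vtx(g′) ∩ {w_j = 0} ⊆ Vtx(shear g)`, (VT)(iii) `e_G′ ≤ e_G` with the trace bound, (E1-FREE), FT(p,p) assembly.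
bears_on: LADDER-RESOLUTION:D157-DOOR2 (res-dim4-pi · K2(p) · I-4-6 (VT)(ii)).  Supports
stmt-ResolutionOfSingularities-16155 (helper).
-/

set_option linter.dupNamespace false -- mandated namespace of this single-conjunct summit

noncomputable section

namespace Summit.ResolutionOfSingularities.ResolutionOfSingularities.Theorems.PIDim4

namespace ResCone

open MvPolynomial Finset
open Literature.AlgebraicGeometry.Resolution
open Literature.AlgebraicGeometry.Resolution.CentreBlowup
open Literature.AlgebraicGeometry.Resolution.Hauser2010
open Literature.AlgebraicGeometry.Resolution.HauserPerlega2019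
open PointBlowup (polarMap additiveSubspace direction)

variable {K : Type} [Field K]

/-! ## 1. Kill-variable, shear and polar calculus -/

/-- Coefficients of the `x_j`-free part `PointBlowup.killVar j P` (`x_j ↦ 0`). [folklore] -/
theorem coeff_killVar (j : Fin 4) (P : MvPolynomial (Fin 4) K) (γ : Fin 4 →₀ ℕ) :
    coeff γ (PointBlowup.killVar j P) = if γ j = 0 then coeff γ P else 0 := by
  classical
  induction P using MvPolynomial.induction_on' with
  | monomial d c =>
    unfold PointBlowup.killVar
    rw [aeval_monomial, MvPolynomial.algebraMap_eq, coeff_monomial]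
    by_cases hdj : d j = 0
    · have hprod : (d.prod fun i k => ((if i = j then 0 else X i : MvPolynomial (Fin 4) K)) ^ k) =
          d.prod fun i k => (X i : MvPolynomial (Fin 4) K) ^ k := by
        rw [Finsupp.prod, Finsupp.prod]
        refine Finset.prod_congr rfl fun i hi => ?_
        have hij : i ≠ j := fun h => (Finsupp.mem_support_iff.mp hi) (h ▸ hdj)
        rw [if_neg hij]
      rw [hprod, Finsupp.prod, prod_X_pow_eq_monomial, C_mul_monomial, mul_one, coeff_monomial]
      by_cases hdγ : d = γ
      · subst hdγ; rw [if_pos rfl, if_pos hdj]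
      · rw [if_neg hdγ]; split_ifs <;> rfl
    · have hj : j ∈ d.support := Finsupp.mem_support_iff.mpr hdj
      rw [Finsupp.prod, Finset.prod_eq_zero hj (by rw [if_pos rfl, zero_pow hdj]), mul_zero, coeff_zero]
      by_cases hdγ : d = γ
      · subst hdγ; rw [if_neg hdj]
      · rw [if_neg hdγ]; split_ifs <;> rfl
  | add f g hf hg =>
    rw [map_add, coeff_add, coeff_add, hf, hg]
    split_ifs <;> ring

/-- An `x_j`-free polynomial is its own `x_j`-free part. [folklore] -/
theorem killVar_eq_self_of_free {j : Fin 4} {P : MvPolynomial (Fin 4) K} (h : ∀ e ∈ P.support, e j = 0) :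
    PointBlowup.killVar j P = P := by
  ext γ
  rw [coeff_killVar]
  split_ifs with hγ
  · rfl
  · exact (MvPolynomial.notMem_support_iff.mp fun hm => hγ (h γ hm)).symm

/-- `∂_i` commutes with `x_j ↦ 0` for `i ≠ j`. [folklore] -/
theorem pderiv_killVar_of_ne {j i : Fin 4} (hij : i ≠ j) (P : MvPolynomial (Fin 4) K) :
    pderiv i (PointBlowup.killVar j P) = PointBlowup.killVar j (pderiv i P) := by
  ext γ
  rw [coeff_killVar, coeff_pderiv, coeff_pderiv, coeff_killVar]
  have : (γ + Finsupp.single i 1 : Fin 4 →₀ ℕ) j = γ j := by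
    rw [Finsupp.add_apply, Finsupp.single_eq_of_ne hij.symm, add_zero]
  rw [this]
  split_ifs <;> ring

/-- **Polars tangent to `E_j` commute with `x_j ↦ 0`**: for `w_j = 0`,
`polarMap (killVar j P) w = killVar j (polarMap P w)`. [folklore] -/
theorem polarMap_killVar {j : Fin 4} (P : MvPolynomial (Fin 4) K) {w : Fin 4 → K} (hw : w j = 0) :
    polarMap (PointBlowup.killVar j P) w = PointBlowup.killVar j (polarMap P w) := by
  rw [NarrowApolarity.polarMap_apply, NarrowApolarity.polarMap_apply, map_sum]
  refine Finset.sum_congr rfl fun i _ => ?_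
  by_cases hij : i = j
  · subst hij; rw [hw, zero_smul, zero_smul, map_zero]
  · rw [map_smul, pderiv_killVar_of_ne hij]

/-- `∂_i (shear j t Φ) = shear j t (∂_i Φ)` for `i ≠ j` (chain rule; the shear moves only `x_j`).
[cite: Humphreys1990, § 3.10 (chain rule)] -/
theorem pderiv_shear_of_ne {j i : Fin 4} (hij : i ≠ j) (t : Fin 4 → K) (Φ : MvPolynomial (Fin 4) K) :
    pderiv i (shear j t Φ) = shear j t (pderiv i Φ) := by
  classical
  unfold shear
  rw [Literature.Algebra.Polynomial.JacobianCriterion.pderiv_aeval, Finset.sum_eq_single i]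
  · rw [if_neg hij, map_add, pderiv_C_mul, pderiv_X, pderiv_X, Pi.single_eq_same,
      Pi.single_eq_of_ne (Ne.symm hij), mul_zero, add_zero, mul_one]
  · intro k _ hki
    by_cases hkj : k = j
    · subst hkj
      rw [if_pos rfl, pderiv_X, Pi.single_eq_of_ne (Ne.symm hij), mul_zero]
    · rw [if_neg hkj, map_add, pderiv_C_mul, pderiv_X, pderiv_X, Pi.single_eq_of_ne hki,
        Pi.single_eq_of_ne (Ne.symm hij), mul_zero, add_zero, mul_zero]
  · intro h; exact absurd (Finset.mem_univ i) h

/-- The chart-origin coefficient formula without support hypothesis (zero off the image of the support).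
[folklore] -/
theorem coeff_chartTransform_chartExponent' {q : ℕ} {j : Fin 4} {F : MvPolynomial (Fin 4) K}
    (hq : (q : ℕ∞) ≤ ordAlong Finset.univ F) {e : Fin 4 →₀ ℕ} (he : q ≤ e.degree) :
    coeff (chartExponent q Finset.univ j e) (chartTransform q Finset.univ j F) = coeff e F := by
  classical
  by_cases hmem : e ∈ F.support
  · exact coeff_chartTransform_chartExponent hq hmem
  · rw [MvPolynomial.notMem_support_iff.mp hmem]
    unfold chartTransform
    rw [coeff_sum]
    refine Finset.sum_eq_zero fun d hd => ?_
    rw [coeff_monomial, if_neg]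
    intro h
    rw [chartExponent_univ, chartExponent_univ] at h
    exact hmem (PointBlowup.chartExponent_injective (le_degree_of_mem_support hq hd) he h ▸ hd)

/-! ## 2. The monomials of `shear j b (x^r)` -/

section ShearMonomial

variable [DecidableEq K]

/-- Values of the kept part `r.filter (b · = 0)`. [folklore] -/
theorem filter_apply_eq (r : Fin 4 →₀ ℕ) (b : Fin 4 → K) (i : Fin 4) :
    (r.filter (fun i => b i = 0)) i = if b i = 0 then r i else 0 := Finsupp.filter_apply _ _ _

/-- `shear` fixes the kept monomial `x^{r.filter (b = 0)}` (those variables are not moved). [folklore] -/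
theorem shear_monomial_filter (j : Fin 4) {b : Fin 4 → K} (hbj : b j = 0) (r : Fin 4 →₀ ℕ) :
    shear j b (monomial (r.filter (fun i => b i = 0)) (1 : K)) = monomial (r.filter (fun i => b i = 0)) 1 := by
  rw [monomial_eq, C_1, one_mul, Finsupp.prod_fintype _ _ (fun i => pow_zero _)]
  unfold shear
  rw [map_prod]
  refine Finset.prod_congr rfl fun i _ => ?_
  rw [map_pow, filter_apply_eq]
  by_cases hbi : b i = 0
  · rw [if_pos hbi, aeval_X]
    by_cases hij : i = j
    · subst hij; rw [if_pos rfl]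
    · rw [if_neg hij, hbi, C_0, zero_mul, add_zero]
  · rw [if_neg hbi, pow_zero, pow_zero]

/-- `shear(x^r) = x^{r_kept} · shear(x^{r − r_kept})`. [folklore] -/
theorem shear_monomial_eq_mul (j : Fin 4) {b : Fin 4 → K} (hbj : b j = 0) (r : Fin 4 →₀ ℕ) :
    shear j b (monomial r (1 : K)) =
      monomial (r.filter (fun i => b i = 0)) 1 *
        shear j b (monomial (r - r.filter (fun i => b i = 0)) 1) := by
  have hle : r.filter (fun i => b i = 0) ≤ r := fun i => by rw [filter_apply_eq]; split_ifs <;> omega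
  have hsplit : monomial r (1 : K) =
      monomial (r.filter (fun i => b i = 0)) 1 * monomial (r - r.filter (fun i => b i = 0)) 1 := by
    rw [monomial_mul, one_mul, add_tsub_cancel_of_le hle]
  conv_lhs => rw [hsplit]
  unfold shear
  rw [map_mul]
  congr 1
  exact shear_monomial_filter j hbj r

/-- **Every monomial of `shear j b (x^r)` lies above `x^{r_kept}`.** [folklore] -/
theorem le_of_mem_support_shear_monomial (j : Fin 4) {b : Fin 4 → K} (hbj : b j = 0) (r : Fin 4 →₀ ℕ)
    {μ : Fin 4 →₀ ℕ} (hμ : μ ∈ (shear j b (monomial r (1 : K))).support) :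
    r.filter (fun i => b i = 0) ≤ μ := by
  rw [shear_monomial_eq_mul j hbj, MvPolynomial.mem_support_iff, coeff_monomial_mul'] at hμ
  by_contra h
  exact hμ (if_neg h)

/-- The top monomial of `shear j b (x^r)`: `x_j^A · x^{r_kept}`, `A = Σ_i r_i·[i = j ∨ b_i ≠ 0]`. [folklore] -/
def topMonomial (j : Fin 4) (b : Fin 4 → K) (r : Fin 4 →₀ ℕ) : Fin 4 →₀ ℕ :=
  (r.filter (fun i => b i = 0)).update j (∑ i, r i * (if i = j ∨ b i ≠ 0 then 1 else 0))

/-- Values of the top monomial. [folklore] -/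
theorem topMonomial_apply (j : Fin 4) (b : Fin 4 → K) (r : Fin 4 →₀ ℕ) (i : Fin 4) :
    topMonomial j b r i = if i = j then ∑ k, r k * (if k = j ∨ b k ≠ 0 then 1 else 0)
      else if b i = 0 then r i else 0 := by
  unfold topMonomial
  rw [Finsupp.update_apply]
  by_cases hij : i = j
  · rw [if_pos hij, if_pos hij]
  · rw [if_neg hij, if_neg hij, filter_apply_eq]

/-- The top monomial has degree `|r|`. [folklore] -/
theorem degree_topMonomial (j : Fin 4) (b : Fin 4 → K) (r : Fin 4 →₀ ℕ) :
    (topMonomial j b r).degree = r.degree := by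
  rw [Finsupp.degree_eq_sum, Finsupp.degree_eq_sum]
  simp_rw [topMonomial_apply]
  rw [← Finset.add_sum_erase _ _ (Finset.mem_univ j), ← Finset.add_sum_erase _ (⇑r) (Finset.mem_univ j),
    if_pos rfl, ← Finset.add_sum_erase _ _ (Finset.mem_univ j), if_pos (Or.inl rfl), mul_one, add_assoc]
  congr 1
  rw [← Finset.sum_add_distrib]
  refine Finset.sum_congr rfl fun i hi => ?_
  have hij : i ≠ j := Finset.ne_of_mem_erase hi
  rw [if_neg hij]
  by_cases hbi : b i = 0
  · rw [if_neg (by tauto), if_pos hbi, mul_zero, zero_add]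
  · rw [if_pos (Or.inr hbi), if_neg hbi, mul_one, add_zero]

/-- **The only monomial of `shear j b (x^r)` with maximal `x_j`-exponent is the top monomial**
(it lies above `x^{r_kept}`, has `x_j`-exponent `A` and total degree `|r| = |top|`). [folklore] -/
theorem eq_topMonomial_of_apply_eq (j : Fin 4) {b : Fin 4 → K} (hbj : b j = 0) (r : Fin 4 →₀ ℕ)
    {μ : Fin 4 →₀ ℕ} (hμ : μ ∈ (shear j b (monomial r (1 : K))).support)
    (hμj : μ j = ∑ i, r i * (if i = j ∨ b i ≠ 0 then 1 else 0)) : μ = topMonomial j b r := by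
  have hle : topMonomial j b r ≤ μ := by
    intro i
    rw [topMonomial_apply]
    by_cases hij : i = j
    · rw [if_pos hij, hij, hμj]
    · rw [if_neg hij, ← filter_apply_eq r b i]
      exact le_of_mem_support_shear_monomial j hbj r hμ i
  have hdeg : μ.degree = (topMonomial j b r).degree := by
    rw [degree_topMonomial j b]
    have := Straightening.isHomogeneous_shear_monomial j b r (1 : K) (MvPolynomial.mem_support_iff.mp hμ)
    rwa [weight_one_eq_degree] at this
  -- `top ≤ μ` with equal degrees
  have hsub : (μ - topMonomial j b r).degree = 0 := by
    have h := congrArg Finsupp.degree (tsub_add_cancel_of_le hle)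
    rw [map_add] at h
    omega
  have hzero : μ - topMonomial j b r = 0 := (Finsupp.degree_eq_zero_iff _).mp hsub
  have := tsub_add_cancel_of_le hle
  rw [hzero, zero_add] at this
  exact this.symm

end ShearMonomial

end ResCone

end Summit.ResolutionOfSingularities.ResolutionOfSingularities.Theorems.PIDim4

end
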